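import Summits.BirchSwinnertonDyer.BirchSwinnertonDyer.Theorems.AdditiveBranchIMCGenusKolyvaginTransportAdapters
import Literature.NumberTheory.EllipticCurves.HeegnerPointsOfConductor
import Mathlib.NumberTheory.LegendreSymbol.JacobiSymbol
import HarnessLib

/-!
# Crux `GordTwoRankZeroOffCaseOne` (+ twin `MultLower`): SIGN BOOKKEEPING for the genus family (the roots
# `ϑ_m = χ(m)·θ`, complex conjugation and Galois elements on them) and label (B3) CONJUGATION one level at a time

Cell `bsd-addord`, lead seat `cruxlead-19357` (g2); HELPER for the registered stub `stub_genusKolyvaginPointsR[M]`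
(lead report 4 §2), landed `--supports … --as helper`. THEOREMS ONLY (no definition, no named fact, no `sorry`).

## What

* §1 complex bookkeeping: a nonzero `z ∈ ℂ` with `z² = d ∈ ℤ` has `conj z = sgn(d)·z`
  (`conj_eq_intSign_mul_of_sq_eq_intCast`); the sign function `χ(m) := if J(d | m) = −1 then −1 else 1 ∈ {±1}`,
  equal to the Jacobi symbol when `gcd(d, m) = 1` and multiplicative there (`χ(ℓm′) = (d/ℓ)χ(m′)`).
* §2 the root `ϑ = χ·θ ∈ K″[m]` (`θ = √d ∈ K″[1] ⊆ K″[m]`): membership, `ϑ² = d`, `ϑ ≠ 0`, and the three signs a label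
  needs — complex conjugation acts by `sgn(d)` (`apply_root_eq_of_conj`), an automorphism fixing the values of `K″[m′] ⊇ K″[1]`
  fixes it, and a `σ′ ∈ 𝒢_m` PINNED to `σ₁ ∈ 𝒢_1` on `K″[1]` (`GrossLMS1991.prop53_conj_pinned_birch`) acts by the genus
  sign `u₁ = σ₁θ/θ` (`apply_root_eq_of_pinned`).
* §3 **`label_B3_level`**: if `τ y − ε′ σ′ y` has finite order on `E′` (Gross 5.3), `τ ϑ = u_τ ϑ`, `σ′ ϑ = u₁ ϑ`, then
  `τ Θ_ϑ(y) − (ε′ u_τ u₁) σ′ Θ_ϑ(y)` has finite order on `Wd` (`pointGalHom_twist'` twice; `Θ` preserves finite order).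

HONEST FRAMING: elementary algebra; no stub is closed by this file alone. BSD is not proved by any of this.
[cite: GrossLMS1991, Prop. 5.3] [cite: SilvermanAEC2009, X.2 Prop. 2.4, X.5 Cor. 5.4] [cite: Cox2013, §9.A Lemma 9.3]
presearch: n/a (kernel bookkeeping; `lean search 'conj.*sq_eq|genusSign'` → `RingClassGenusCharacter.genusSign` (sign of an
automorphism on `θ`, same idea, different currency) — not restated, only `±1`-valued equalities are used here).
-/

noncomputable section

open scoped Classical ComplexConjugate

set_option linter.dupNamespace false
set_option autoImplicit false

namespace Summit.BirchSwinnertonDyer.BirchSwinnertonDyer.Theorems.GenusKolyvagin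

open WeierstrassCurve NumberField Literature.NumberTheory.EllipticCurves
  Literature.NumberTheory.EllipticCurves.ModularForms

/-! ## §1 Complex square roots of integers; the sign function `χ` -/

/-- **`conj z = sgn(d)·z` for `z² = d ∈ ℤ`, `z ≠ 0`** (`z` is real if `d > 0`, purely imaginary if `d < 0`). [folklore] -/
theorem conj_eq_intSign_mul_of_sq_eq_intCast {z : ℂ} {d : ℤ} (hz : z ^ 2 = (d : ℂ)) (hz0 : z ≠ 0) :
    conj z = ((Int.sign d : ℤ) : ℂ) * z := by
  have hre2 : z.re * z.re - z.im * z.im = (d : ℝ) := by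
    have h := congrArg Complex.re hz
    rw [sq, Complex.mul_re] at h
    simpa using h
  have him2 : z.re * z.im = 0 := by
    have h := congrArg Complex.im hz
    rw [sq, Complex.mul_im] at h
    simp only [Complex.intCast_im] at h
    linarith [mul_comm z.im z.re]
  rcases mul_eq_zero.mp him2 with hre0 | him0
  · -- purely imaginary: `d = -(im z)² < 0`
    have hzim : z.im ≠ 0 := fun h' => hz0 (Complex.ext hre0 h')
    have hdneg : d < 0 := by
      have : (d : ℝ) < 0 := by
        rw [← hre2, hre0]; nlinarith [sq_pos_of_ne_zero hzim]
      exact_mod_cast this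
    rw [Int.sign_eq_neg_one_of_neg hdneg]
    apply Complex.ext <;> simp [hre0]
  · -- real: `d = (re z)² > 0`
    have hzre : z.re ≠ 0 := fun h' => hz0 (Complex.ext h' him0)
    have hdpos : 0 < d := by
      have : (0 : ℝ) < d := by
        rw [← hre2, him0]; nlinarith [sq_pos_of_ne_zero hzre]
      exact_mod_cast this
    rw [Int.sign_eq_one_of_pos hdpos]
    apply Complex.ext <;> simp [him0]

/-- The genus sign at a level: `χ = if J(d | m) = −1 then −1 else 1`; always `±1`. [folklore] -/
theorem levelSign_eq_one_or (d : ℤ) (m : ℕ) :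
    (if jacobiSym d m = -1 then (-1 : ℤ) else 1) = 1 ∨ (if jacobiSym d m = -1 then (-1 : ℤ) else 1) = -1 := by
  split_ifs <;> simp

/-- For `gcd(d, m) = 1` the genus sign IS the Jacobi symbol. [cite: IrelandRosen1990, §5.2 (Jacobi symbol)] -/
theorem levelSign_eq_jacobiSym {d : ℤ} {m : ℕ} (h : d.gcd m = 1) :
    (if jacobiSym d m = -1 then (-1 : ℤ) else 1) = jacobiSym d m := by
  rcases jacobiSym.eq_one_or_neg_one h with h1 | h1 <;> simp [h1]

/-- Multiplicativity at a prime factor: `χ(m) = (d/ℓ)·χ(m/ℓ)` for `ℓ ∣ m`, `gcd(d, m) = 1`.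
[cite: IrelandRosen1990, Prop. 5.2.2] -/
theorem levelSign_eq_legendreSym_mul {d : ℤ} {m ℓ : ℕ} [Fact ℓ.Prime] (hℓm : ℓ ∣ m) (hm : m ≠ 0)
    (h : d.gcd m = 1) :
    (if jacobiSym d m = -1 then (-1 : ℤ) else 1) =
      legendreSym ℓ d * (if jacobiSym d (m / ℓ) = -1 then (-1 : ℤ) else 1) := by
  have hℓ : ℓ.Prime := Fact.out
  have hn : ℓ * (m / ℓ) = m := Nat.mul_div_cancel' hℓm
  have hm'0 : m / ℓ ≠ 0 := fun h' => hm (by rw [← hn, h', mul_zero])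
  have h' : d.gcd (m / ℓ : ℕ) = 1 := Nat.Coprime.coprime_dvd_right (Nat.div_dvd_of_dvd hℓm) h
  rw [levelSign_eq_jacobiSym h, levelSign_eq_jacobiSym h']
  conv_lhs => rw [← hn]
  rw [jacobiSym.mul_right' d hℓ.ne_zero hm'0, jacobiSym.legendreSym.to_jacobiSym]

/-! ## §2 The root `ϑ = χ·θ ∈ K″[m]` -/

section Root

variable {K : Type} [Field K] [NumberField K]

/-- `χ·θ ∈ K″[m]` for `θ ∈ K″[1]`, `m ≠ 0` (`K″[1] ⊆ K″[m]`). [cite: Cox2013, §9.A] -/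
theorem intCast_mul_mem_ringClassField (hK : IsImaginaryQuadratic K) (ι : K →+* ℂ) {m : ℕ} (hm : m ≠ 0)
    (u : ℤ) (θ : ringClassField K ι 1) : (u : ℂ) * (θ : ℂ) ∈ ringClassField K ι m :=
  Subfield.mul_mem _ (Subfield.intCast_mem _ u) (ringClassField_mono hK ι (one_dvd m) hm θ.2)

/-- The complex value of the root `ϑ = u·θ↑`. [folklore] -/
theorem coe_root (ι : K →+* ℂ) {m : ℕ} (h1m : ringClassField K ι 1 ≤ ringClassField K ι m) {u : ℤ}
    {θ : ringClassField K ι 1} {ϑ : ringClassField K ι m}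
    (hϑ : ϑ = (u : ringClassField K ι m) * RingClassField.inclusion ι h1m θ) :
    (ϑ : ℂ) = (u : ℂ) * (θ : ℂ) := by
  rw [hϑ, Subfield.coe_mul, RingClassField.coe_inclusion]
  push_cast
  rfl

/-- `(u·θ↑)² = d` for `θ² = d`, `u = ±1`. [folklore] -/
theorem root_sq_eq (ι : K →+* ℂ) {m : ℕ} (h1m : ringClassField K ι 1 ≤ ringClassField K ι m) {d : ℤ}
    {u : ℤ} (hu : u = 1 ∨ u = -1) {θ : ringClassField K ι 1}
    (hθ2 : θ ^ 2 = algebraMap ℚ (ringClassField K ι 1) (d : ℚ)) {ϑ : ringClassField K ι m}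
    (hϑ : ϑ = (u : ringClassField K ι m) * RingClassField.inclusion ι h1m θ) :
    ϑ ^ 2 = algebraMap ℚ (ringClassField K ι m) (d : ℚ) := by
  have hu2 : ((u : ringClassField K ι m)) ^ 2 = 1 := by rcases hu with rfl | rfl <;> norm_num
  rw [hϑ, mul_pow, hu2, one_mul, ← map_pow, hθ2]
  exact ((RingClassField.inclusion ι h1m).restrictScalars ℚ).commutes (d : ℚ)

/-- `u·θ↑ ≠ 0`. [folklore] -/
theorem root_ne_zero (ι : K →+* ℂ) {m : ℕ} (h1m : ringClassField K ι 1 ≤ ringClassField K ι m) {u : ℤ}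
    (hu : u = 1 ∨ u = -1) {θ : ringClassField K ι 1} (hθ0 : θ ≠ 0) {ϑ : ringClassField K ι m}
    (hϑ : ϑ = (u : ringClassField K ι m) * RingClassField.inclusion ι h1m θ) : ϑ ≠ 0 := by
  rw [hϑ]
  refine mul_ne_zero ?_ ((map_ne_zero_iff _ (RingClassField.inclusion_injective ι h1m)).mpr hθ0)
  rcases hu with rfl | rfl <;> norm_num

/-- **Complex conjugation on the root**: for `τ ∈ Aut(K″[m])` acting as complex conjugation and `θ² = d`, `θ ≠ 0`:
`τ(u·θ) = sgn(d)·(u·θ)`. [cite: GrossLMS1991, §5 (τ)] -/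
theorem apply_root_eq_of_conj (ι : K →+* ℂ) {m : ℕ} {d : ℤ} {u : ℤ} {θ : ringClassField K ι 1}
    (hθ2 : θ ^ 2 = algebraMap ℚ (ringClassField K ι 1) (d : ℚ)) (hθ0 : θ ≠ 0)
    {ϑ : ringClassField K ι m} (hϑ : (ϑ : ℂ) = (u : ℂ) * (θ : ℂ))
    (τ : ringClassField K ι m ≃ₐ[ℚ] ringClassField K ι m)
    (hτ : ∀ x : ringClassField K ι m, ((τ x : ringClassField K ι m) : ℂ) = conj (x : ℂ)) :
    τ ϑ = ((Int.sign d : ℤ) : ringClassField K ι m) * ϑ := by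
  apply Subtype.ext
  have hθC : (θ : ℂ) ^ 2 = (d : ℂ) := by
    have := congrArg (fun x : ringClassField K ι 1 => (x : ℂ)) hθ2
    simpa [map_intCast] using this
  have hθC0 : (θ : ℂ) ≠ 0 := fun h => hθ0 (Subtype.ext h)
  rw [hτ, Subfield.coe_mul, hϑ, map_mul, conj_eq_intSign_mul_of_sq_eq_intCast hθC hθC0]
  push_cast
  simp only [map_intCast]
  ring

/-- **An automorphism fixing the complex values of `K″[m′] ⊇ K″[1]` fixes the root.** [cite: Cox2013, §9.A] -/
theorem apply_root_eq_of_mem_fixing (hK : IsImaginaryQuadratic K) (ι : K →+* ℂ) {m m' : ℕ} (hm' : m' ≠ 0)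
    {u : ℤ} {θ : ringClassField K ι 1} {ϑ : ringClassField K ι m} (hϑ : (ϑ : ℂ) = (u : ℂ) * (θ : ℂ))
    {σ : ringClassField K ι m ≃ₐ[ℚ] ringClassField K ι m} (hσ : σ ∈ ringClassGalOver ι m m') :
    σ ϑ = ϑ :=
  (mem_fixingSubgroup_iff _).mp hσ ϑ (by
    show (ϑ : ℂ) ∈ ringClassField K ι m'
    rw [hϑ]; exact intCast_mul_mem_ringClassField hK ι hm' u θ)

/-- **A Galois element pinned on `K″[1]` acts on the root by the genus sign of its pin**: if `σ′ ∈ Aut(K″[m])` agrees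
with `σ₁ ∈ Aut(K″[1])` on the complex values of `K″[1]` and `σ₁ θ = u₁ θ`, then `σ′(u·θ) = u₁·(u·θ)`.
[cite: GrossLMS1991, Prop. 5.3 (proof: σ′ = σ(𝔫))] -/
theorem apply_root_eq_of_pinned (ι : K →+* ℂ) {m : ℕ} {u u₁ : ℤ} {θ : ringClassField K ι 1}
    {ϑ : ringClassField K ι m} (hϑ : (ϑ : ℂ) = (u : ℂ) * (θ : ℂ))
    {σ' : ringClassField K ι m ≃ₐ[ℚ] ringClassField K ι m}
    {σ₁ : ringClassField K ι 1 ≃ₐ[ℚ] ringClassField K ι 1}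
    (hpin : ∀ (x₁ : ringClassField K ι 1) (x : ringClassField K ι m), (x : ℂ) = (x₁ : ℂ) →
      ((σ' x : ringClassField K ι m) : ℂ) = ((σ₁ x₁ : ringClassField K ι 1) : ℂ))
    (hσ₁ : σ₁ θ = ((u₁ : ℤ) : ringClassField K ι 1) * θ) :
    σ' ϑ = ((u₁ : ℤ) : ringClassField K ι m) * ϑ := by
  apply Subtype.ext
  have hx : (ϑ : ℂ) = (((u : ringClassField K ι 1) * θ : ringClassField K ι 1) : ℂ) := by
    rw [hϑ, Subfield.coe_mul]; push_cast; rfl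
  rw [hpin _ _ hx, map_mul, map_intCast, hσ₁, Subfield.coe_mul, Subfield.coe_mul, Subfield.coe_mul, hϑ]
  push_cast
  ring

end Root

/-! ## §3 Label (B3): complex conjugation on the transported point, one level -/

section B3

variable {K : Type} [Field K] [NumberField K]

/-- **(B3) for the genus family at one level.** If `τ y − ε′ σ′ y` has finite order in `E′(K″[m])` and `τ ϑ = u_τ ϑ`,
`σ′ ϑ = u₁ ϑ` (`u_τ, u₁ = ±1`), then `τ Θ_ϑ(y) − (ε′ u_τ u₁) σ′ Θ_ϑ(y)` has finite order in `Wd(K″[m])`.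
[cite: GrossLMS1991, Prop. 5.3] [cite: SilvermanAEC2009, X.2 Prop. 2.4] -/
theorem label_B3_level (ι : K →+* ℂ) (E' : WeierstrassCurve ℚ) (D C₂ : VariableChange ℚ)
    [(D • E').IsCharNeTwoNF] (d₁ : ℤ) {m : ℕ}
    {ϑ : ringClassField K ι m} (hϑ2 : ϑ ^ 2 = algebraMap ℚ (ringClassField K ι m) (d₁ : ℚ)) (hϑ0 : ϑ ≠ 0)
    {τ σ' : ringClassField K ι m ≃ₐ[ℚ] ringClassField K ι m} {uτ u₁ ε' : ℤ}
    (huτ : uτ = 1 ∨ uτ = -1) (hu₁ : u₁ = 1 ∨ u₁ = -1)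
    (hτϑ : τ ϑ = (uτ : ringClassField K ι m) * ϑ) (hσϑ : σ' ϑ = (u₁ : ringClassField K ι m) * ϑ)
    {y : (E'.baseChange (ringClassField K ι m)).toAffine.Point}
    (hy : IsOfFinAddOrder (pointGalHom E' (ringClassField K ι m) τ y -
      ε' • pointGalHom E' (ringClassField K ι m) σ' y)) :
    IsOfFinAddOrder
      (pointGalHom (C₂ • (D • E').quadraticTwist (d₁ : ℚ)) (ringClassField K ι m) τ
          (VariableChange.pointEquivBaseChange ((D • E').quadraticTwist (d₁ : ℚ)) C₂ (ringClassField K ι m)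
          ((VariableChange.pointEquiv (((D • E').quadraticTwist (d₁ : ℚ)).baseChange (ringClassField K ι m)) (untwistAt hϑ0)).symm
            ((Affine.Point.congrEquiv (untwistAt_smul_eq (D • E') hϑ2 hϑ0)).symm
              (VariableChange.pointEquivBaseChange E' D (ringClassField K ι m) y)))) -
        (ε' * uτ * u₁) • pointGalHom (C₂ • (D • E').quadraticTwist (d₁ : ℚ)) (ringClassField K ι m) σ'
          (VariableChange.pointEquivBaseChange ((D • E').quadraticTwist (d₁ : ℚ)) C₂ (ringClassField K ι m)
          ((VariableChange.pointEquiv (((D • E').quadraticTwist (d₁ : ℚ)).baseChange (ringClassField K ι m)) (untwistAt hϑ0)).symm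
            ((Affine.Point.congrEquiv (untwistAt_smul_eq (D • E') hϑ2 hϑ0)).symm
              (VariableChange.pointEquivBaseChange E' D (ringClassField K ι m) y))))) := by
  have hτ' := pointGalHom_twist' E' D C₂ (d₁ : ℚ) hϑ2 hϑ0 τ huτ hτϑ y
  have hσ'' := pointGalHom_twist' E' D C₂ (d₁ : ℚ) hϑ2 hϑ0 σ' hu₁ hσϑ y
  -- `Θ` applied to the finite-order point `τ y − ε′ σ′ y`
  have hfin := isOfFinAddOrder_twist' E' D C₂ (d₁ : ℚ) hϑ2 hϑ0 hy
  rw [map_sub, map_sub, map_sub, map_sub, map_zsmul, map_zsmul, map_zsmul, map_zsmul] at hfin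
  -- express `Θ(τ y)` and `Θ(σ′ y)` through `τ Θ y`, `σ′ Θ y`
  have huτ2 : uτ * uτ = 1 := by rcases huτ with rfl | rfl <;> norm_num
  have hu₁2 : u₁ * u₁ = 1 := by rcases hu₁ with rfl | rfl <;> norm_num
  have e1 : (VariableChange.pointEquivBaseChange ((D • E').quadraticTwist (d₁ : ℚ)) C₂ (ringClassField K ι m)
          ((VariableChange.pointEquiv (((D • E').quadraticTwist (d₁ : ℚ)).baseChange (ringClassField K ι m)) (untwistAt hϑ0)).symm
            ((Affine.Point.congrEquiv (untwistAt_smul_eq (D • E') hϑ2 hϑ0)).symm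
              (VariableChange.pointEquivBaseChange E' D (ringClassField K ι m) (pointGalHom E' (ringClassField K ι m) τ y))))) = uτ • pointGalHom (C₂ • (D • E').quadraticTwist (d₁ : ℚ)) (ringClassField K ι m) τ (VariableChange.pointEquivBaseChange ((D • E').quadraticTwist (d₁ : ℚ)) C₂ (ringClassField K ι m)
          ((VariableChange.pointEquiv (((D • E').quadraticTwist (d₁ : ℚ)).baseChange (ringClassField K ι m)) (untwistAt hϑ0)).symm
            ((Affine.Point.congrEquiv (untwistAt_smul_eq (D • E') hϑ2 hϑ0)).symm
              (VariableChange.pointEquivBaseChange E' D (ringClassField K ι m) y)))) := by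
    rw [hτ', smul_smul, huτ2, one_smul]
  have e2 : (VariableChange.pointEquivBaseChange ((D • E').quadraticTwist (d₁ : ℚ)) C₂ (ringClassField K ι m)
          ((VariableChange.pointEquiv (((D • E').quadraticTwist (d₁ : ℚ)).baseChange (ringClassField K ι m)) (untwistAt hϑ0)).symm
            ((Affine.Point.congrEquiv (untwistAt_smul_eq (D • E') hϑ2 hϑ0)).symm
              (VariableChange.pointEquivBaseChange E' D (ringClassField K ι m) (pointGalHom E' (ringClassField K ι m) σ' y))))) = u₁ • pointGalHom (C₂ • (D • E').quadraticTwist (d₁ : ℚ)) (ringClassField K ι m) σ' (VariableChange.pointEquivBaseChange ((D • E').quadraticTwist (d₁ : ℚ)) C₂ (ringClassField K ι m)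
          ((VariableChange.pointEquiv (((D • E').quadraticTwist (d₁ : ℚ)).baseChange (ringClassField K ι m)) (untwistAt hϑ0)).symm
            ((Affine.Point.congrEquiv (untwistAt_smul_eq (D • E') hϑ2 hϑ0)).symm
              (VariableChange.pointEquivBaseChange E' D (ringClassField K ι m) y)))) := by
    rw [hσ'', smul_smul, hu₁2, one_smul]
  rw [e1, e2, smul_smul] at hfin
  have key : pointGalHom (C₂ • (D • E').quadraticTwist (d₁ : ℚ)) (ringClassField K ι m) τ
          (VariableChange.pointEquivBaseChange ((D • E').quadraticTwist (d₁ : ℚ)) C₂ (ringClassField K ι m)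
          ((VariableChange.pointEquiv (((D • E').quadraticTwist (d₁ : ℚ)).baseChange (ringClassField K ι m)) (untwistAt hϑ0)).symm
            ((Affine.Point.congrEquiv (untwistAt_smul_eq (D • E') hϑ2 hϑ0)).symm
              (VariableChange.pointEquivBaseChange E' D (ringClassField K ι m) y)))) -
        (ε' * uτ * u₁) • pointGalHom (C₂ • (D • E').quadraticTwist (d₁ : ℚ)) (ringClassField K ι m) σ'
          (VariableChange.pointEquivBaseChange ((D • E').quadraticTwist (d₁ : ℚ)) C₂ (ringClassField K ι m)
          ((VariableChange.pointEquiv (((D • E').quadraticTwist (d₁ : ℚ)).baseChange (ringClassField K ι m)) (untwistAt hϑ0)).symm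
            ((Affine.Point.congrEquiv (untwistAt_smul_eq (D • E') hϑ2 hϑ0)).symm
              (VariableChange.pointEquivBaseChange E' D (ringClassField K ι m) y)))) =
      uτ • (uτ • pointGalHom (C₂ • (D • E').quadraticTwist (d₁ : ℚ)) (ringClassField K ι m) τ
          (VariableChange.pointEquivBaseChange ((D • E').quadraticTwist (d₁ : ℚ)) C₂ (ringClassField K ι m)
          ((VariableChange.pointEquiv (((D • E').quadraticTwist (d₁ : ℚ)).baseChange (ringClassField K ι m)) (untwistAt hϑ0)).symm
            ((Affine.Point.congrEquiv (untwistAt_smul_eq (D • E') hϑ2 hϑ0)).symm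
              (VariableChange.pointEquivBaseChange E' D (ringClassField K ι m) y)))) -
        (ε' * u₁) • pointGalHom (C₂ • (D • E').quadraticTwist (d₁ : ℚ)) (ringClassField K ι m) σ'
          (VariableChange.pointEquivBaseChange ((D • E').quadraticTwist (d₁ : ℚ)) C₂ (ringClassField K ι m)
          ((VariableChange.pointEquiv (((D • E').quadraticTwist (d₁ : ℚ)).baseChange (ringClassField K ι m)) (untwistAt hϑ0)).symm
            ((Affine.Point.congrEquiv (untwistAt_smul_eq (D • E') hϑ2 hϑ0)).symm
              (VariableChange.pointEquivBaseChange E' D (ringClassField K ι m) y))))) := by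
    rw [smul_sub, smul_smul, smul_smul, huτ2, one_smul, show uτ * (ε' * u₁) = ε' * uτ * u₁ by ring]
  rw [key]
  exact hfin.zsmul

end B3

end Summit.BirchSwinnertonDyer.BirchSwinnertonDyer.Theorems.GenusKolyvagin

end
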